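import Literature.MathematicalPhysics.QuantumFieldTheory.Balaban1983to89.B9Eq349BlockMultipliers
import Literature.MathematicalPhysics.QuantumFieldTheory.Balaban1983to89.B9Eq3101DoubleCommutatorBlockSchur

/-!
# `Balaban1983to89.B9Eq389CutoffTailFromBlockDecay` — T. Bałaban, *Propagators for lattice gauge theories in a background field*, Commun. Math. Phys. **99**
# (1985) 389–434 [Balaban1985BackgroundPropagators] (3.89) p. 409 («|(K(h_□)G′_□h_□λ)(x)| ≤ O(M⁻¹)e^{−δ₀ dist}|λ|»), (3.49) p. 399, Cor. 3.6 p. 408: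
# **THE CUT-OFF TAIL LETTER FROM A BLOCK-DECAY LETTER — if an operator `T` on `L²(sites)` has block entries `‖P_{y₁}TP_{y₀}‖ ≤ C·e^{−κ·d_m(y₀,y₁)}` and a
# pointwise multiplier `M = μ·` with `|μ| ≤ 1` VANISHES on every block within coarse distance `r₀` of a set `Y₀`, then for every `f` supported in the blocks
# over `Y₀`: `‖M(Tf)‖ ≤ C·K_d(κ∕2)·e^{−(κ∕2)r₀}·‖f‖`** — the `hτ : ‖θ(R′w) − R′w‖ ≤ τ‖w‖` letter of S-P6′(β)
# `B9Eq387CubeLocalisedProjection.norm_sub_projR_cube_le_nearfield` (with `M := 1 − θ`, `T := R′`, `w` supported `r₀` blocks inside `{θ = 1}`) from ANY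
# sites→sites block-decay supplier, by the block Schur test

statement-level skeleton of published theorems with citation tags; proofs where landed; nothing here is a claim about the Yang–Mills mass gap

CITATION HEADER (lean-in-tree rule).  Audit cell `pub-balaban`, sub-cell `t4`, BINDER row NE9; filed by NE9 formalisation-swarm LEAF PROVER 05
(`b2b-balaban-t4-ne9-formalise-leaf-05`, gen 76), route R2′ STEP B8′ S-P6′(β) (ROUTES-NE9 §L1.2).  TOOLS BY NAME: ne9-leaf-01's (B)
`B9Eq3101DoubleCommutatorBlockSchur.family_block_schur_sq` (the block Schur test), (K1) `B9Eq349BlockMultipliers` (block families, multipliers, eigen- and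
vanishing relations, both Bessel directions), the cell's `B4Sect5Torus.torusSum_le` (`Σ_y e^{−a·d_m(x,y)} ≤ K_d(a) = latticeConst d a`).  Sources READ:
[Balaban1985BackgroundPropagators] p. 409 (3.89), p. 399 (3.49) *«… ≤ O(1)e^{−δ₀d(y,y′)}‖f‖ for x ∈ Δ(y), supp f ⊂ Δ(y′)»*, p. 408 Cor. 3.6.  Print reads the
tail off its random-walk expansion; here it is the generic consequence of ANY block-decay letter — [folklore], NOTHING of print's `δ₀`∕`O(1)` asserted.

WHY.  In (β) the decay of `R′ = R(U)` enters through ONE letter, `hτ : ‖θ(R′w) − R′w‖ ≤ τ‖w‖` for an input `w` supported deep inside the flat region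
`{θ = 1}` of the cube's cut-off.  Road B8″ (ne9-leaf-06∕-01) produces BLOCK-DECAY letters (`‖P_{y₁}TP_{y₀}‖ ≤ Ce^{−κd}`); this file is the bridge:
`(θ − 1)R′w = M(Tw)` with `M = θ − 1` (a multiplier of modulus `≤ 1` vanishing near `supp w`), and the Schur test over the block entries
`‖P_B M T Π_{Y₀} P_A‖ ≤ 1_{A ∈ Y₀}1_{B far}·Ce^{−κ d(A,B)} ≤ Ce^{−κr₀∕2}·e^{−(κ∕2)d(A,B)}` gives `τ = C·K_d(κ∕2)·e^{−κr₀∕2}`.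

WHAT IS PROVED (sorry-free; proof lane — no `def`; [folklore] Schur test + support bookkeeping BY NAME).
* §1 `sum_filter_block_apply_eq_self` — a function supported in the blocks over `Y₀` is fixed by `Π_{Y₀} = Σ_{A∈Y₀} P_A`; `comp_sum_filter_block_comp_block`
  (`Π_{Y₀} ∘ P_A = 1_{A∈Y₀}·P_A`).
* §2 `norm_block_entry_le_far` — the entry bound `‖P_B ∘ (M ∘ T ∘ Π_{Y₀}) ∘ P_A‖ ≤ C·e^{−κr₀∕2}·e^{−(κ∕2)·d_m(A,B)}` (zero unless `A ∈ Y₀` and `B` far).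
* §3 **`norm_mul_apply_le_of_block_decay`** — THE TAIL LETTER: `‖M(Tf)‖ ≤ C·latticeConst d (κ∕2)·e^{−(κ∕2)r₀}·‖f‖` for `f` supported over `Y₀`.
HONEST SCOPE.  Generic (any weighted `L²` carrier, any block map `π` onto a torus `TSite d m`, any `T`); the rate halves (`κ ↦ κ∕2`) to pay the lattice sum —
crude and standard; no instance (`θ = h_z`, `T = R(U)`, the size of `Y₀`) is built here; ONE letter of ONE sub-step of a route step, NOT NE9 (cell pub-balaban:
NE9 NOT PRINTED ∕ NOT PROVED; «NE9 ⇐ the named binders»; row WALLED ON A MODEL (O-NE9-1; #5 UNRULED); spine PROVED 0∕9; rung (B)+1 on a finite T⁴ — NOT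
infinite volume, NOT mass gap, NOT BetaPertH, NOT Clay; HONEST DEPENDENCY: continuum YM on T⁴ ⇐ BetaPertH ∧ nine spine estimates (0/9 proved); BetaPertH ⇐
(D1) ∧ (D4) ∧ CAP+tail; G-an2-4 gates asym, D1 and NE2/3/4).  NEW file; imports (K1) + (B); nothing modified.  Net new unproved facts: 0.
-/

noncomputable section

open scoped BigOperators InnerProductSpace
open ContinuousLinearMap

namespace Literature.MathematicalPhysics.QuantumFieldTheory.Balaban1983to89.B9Eq389CutoffTailFromBlockDecay

open B4Sect5Torus (TSite tdist tdist_symm tdist_nonneg torusSum_le)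
open B4Sect5Proof (latticeConst)
open B9Eq311L2Pairing (WL2)
open B9Eq349BlockMultipliers (block_comp_self block_comp_block_of_ne sum_block_apply sum_norm_sq_block_apply_le norm_sq_le_sum_norm_sq_block_apply
  opNorm_block_le block_comp_mul_eq_mul_comp_block mul_comp_block_eq_zero)
open B9Eq311PointwiseMultipliers (norm_apply_le_of_pointwise)
open B9Eq3101DoubleCommutatorBlockSchur (family_block_schur_sq)

variable {𝕜 : Type*} [RCLike 𝕜] {X : Type*} [Fintype X] {w : X → ℝ} [Fact (∀ x, 0 < w x)]
  {V : Type*} [NormedAddCommGroup V] [InnerProductSpace 𝕜 V]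
  {d : ℕ} {m : Fin d → ℕ} {π : X → TSite d m} {P : TSite d m → WL2 𝕜 w V →L[𝕜] WL2 𝕜 w V}
  (hP : ∀ (y : TSite d m) (f : WL2 𝕜 w V) (x : X), WL2.equiv 𝕜 w V (P y f) x = if π x = y then WL2.equiv 𝕜 w V f x else 0)

/-! ## §1 Support over a set of blocks -/

include hP in
/-- A function vanishing off the blocks over `Y₀` is fixed by `Π_{Y₀} = Σ_{A ∈ Y₀} P_A`. [folklore] [cite: Balaban1985BackgroundPropagators, (3.49) p.399 «supp f ⊂ Δ(y′)»] -/
theorem sum_filter_block_apply_eq_self (Y₀ : Finset (TSite d m)) (f : WL2 𝕜 w V) (hf : ∀ x, π x ∉ Y₀ → WL2.equiv 𝕜 w V f x = 0) :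
    (∑ A ∈ Y₀, P A) f = f := by
  classical
  apply (WL2.linearEquiv 𝕜 𝕜 w (V := V)).injective
  funext x
  rw [FunLike.coe_sum, Finset.sum_apply, map_sum, Finset.sum_apply]
  simp only [WL2.linearEquiv_apply, hP]
  by_cases hx : π x ∈ Y₀
  · rw [Finset.sum_eq_single (π x) (fun A _ hA => if_neg (Ne.symm hA)) (fun h => (h hx).elim), if_pos rfl]
  · rw [Finset.sum_eq_zero (fun A hA => if_neg (fun h => hx (by rw [h]; exact hA))), hf x hx]

include hP in
/-- `Π_{Y₀} ∘ P_A = P_A` if `A ∈ Y₀`, `= 0` otherwise. [folklore] [cite: Balaban1985BackgroundPropagators, (3.49) p.399] -/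
theorem comp_sum_filter_block_comp_block (Y₀ : Finset (TSite d m)) (A : TSite d m) :
    (∑ A' ∈ Y₀, P A') ∘L P A = if A ∈ Y₀ then P A else 0 := by
  classical
  rw [ContinuousLinearMap.finsetSum_comp]
  by_cases hA : A ∈ Y₀
  · rw [if_pos hA, Finset.sum_eq_single A (fun A' _ hA' => block_comp_block_of_ne hP hA') (fun h => (h hA).elim), block_comp_self hP]
  · rw [if_neg hA]
    exact Finset.sum_eq_zero fun A' hA' => block_comp_block_of_ne hP (fun h => hA (h ▸ hA'))

/-! ## §2 The block entries of `M ∘ T ∘ Π_{Y₀}` -/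

variable {M : WL2 𝕜 w V →L[𝕜] WL2 𝕜 w V} {μ : X → 𝕜}
  (hM : ∀ (f : WL2 𝕜 w V) (x : X), WL2.equiv 𝕜 w V (M f) x = μ x • WL2.equiv 𝕜 w V f x) (hμ1 : ∀ x, ‖μ x‖ ≤ 1)

include hP hM hμ1 in
/-- **THE ENTRY BOUND**: with `‖P_{y₁}TP_{y₀}‖ ≤ Ce^{−κd_m(y₀,y₁)}`, `|μ| ≤ 1` and `μ = 0` on every block `B` with `d_m(y₀, B) < r₀` for some `y₀ ∈ Y₀`:
`‖P_B ∘ (M ∘ T ∘ Π_{Y₀}) ∘ P_A‖ ≤ C·e^{−κr₀∕2}·e^{−(κ∕2)d_m(A,B)}` (the entry vanishes unless `A ∈ Y₀` and `B` is far, where `d_m(A,B) ≥ r₀`).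
[folklore] [cite: Balaban1985BackgroundPropagators, (3.49) p.399, (3.89) p.409] -/
theorem norm_block_entry_le_far (Y₀ : Finset (TSite d m)) {r₀ : ℝ}
    (hnear : ∀ x, (∃ y₀ ∈ Y₀, tdist m y₀ (π x) < r₀) → μ x = 0)
    (T : WL2 𝕜 w V →L[𝕜] WL2 𝕜 w V) {C κ : ℝ} (hC : 0 ≤ C) (hκ : 0 ≤ κ)
    (hdec : ∀ y₀ y₁, ‖P y₁ ∘L T ∘L P y₀‖ ≤ C * Real.exp (-(κ * tdist m y₀ y₁))) (A B : TSite d m) :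
    ‖P B ∘L (M ∘L T ∘L ∑ A' ∈ Y₀, P A') ∘L P A‖ ≤ C * Real.exp (-(κ / 2 * r₀)) * Real.exp (-(κ / 2 * tdist m A B)) := by
  classical
  have h0 : 0 ≤ C * Real.exp (-(κ / 2 * r₀)) * Real.exp (-(κ / 2 * tdist m A B)) := by positivity
  -- reassociate and use `Π_{Y₀} ∘ P_A`
  have e1 : P B ∘L (M ∘L T ∘L ∑ A' ∈ Y₀, P A') ∘L P A = P B ∘L M ∘L T ∘L ((∑ A' ∈ Y₀, P A') ∘L P A) := by
    simp only [ContinuousLinearMap.comp_assoc]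
  rw [e1, comp_sum_filter_block_comp_block hP Y₀ A]
  by_cases hA : A ∈ Y₀
  · rw [if_pos hA]
    by_cases hB : ∃ y₀ ∈ Y₀, tdist m y₀ B < r₀
    · -- near block: `P_B ∘ M = M ∘ P_B = 0`
      have hz : M ∘L P B = 0 := mul_comp_block_eq_zero hP hM B fun x hx => hnear x (by rw [hx]; exact hB)
      have e2 : P B ∘L M ∘L T ∘L P A = (M ∘L P B) ∘L T ∘L P A := by
        rw [← block_comp_mul_eq_mul_comp_block hP hM B]; simp only [ContinuousLinearMap.comp_assoc]
      rw [e2, hz, ContinuousLinearMap.zero_comp, norm_zero]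
      exact h0
    · -- far block: `d(A,B) ≥ r₀`, `‖M‖ ≤ 1`
      push Not at hB
      have hfar : r₀ ≤ tdist m A B := hB A hA
      have e2 : P B ∘L M ∘L T ∘L P A = M ∘L (P B ∘L T ∘L P A) := by
        rw [← ContinuousLinearMap.comp_assoc, block_comp_mul_eq_mul_comp_block hP hM B]; simp only [ContinuousLinearMap.comp_assoc]
      rw [e2]
      have hMn : ‖M‖ ≤ 1 := ContinuousLinearMap.opNorm_le_bound _ zero_le_one fun f => norm_apply_le_of_pointwise hM zero_le_one hμ1 f
      calc ‖M ∘L (P B ∘L T ∘L P A)‖ ≤ ‖M‖ * ‖P B ∘L T ∘L P A‖ := opNorm_comp_le _ _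
        _ ≤ 1 * (C * Real.exp (-(κ * tdist m A B))) := mul_le_mul hMn (hdec A B) (norm_nonneg _) zero_le_one
        _ ≤ C * Real.exp (-(κ / 2 * r₀)) * Real.exp (-(κ / 2 * tdist m A B)) := by
            rw [one_mul, mul_assoc, ← Real.exp_add]
            refine mul_le_mul_of_nonneg_left (Real.exp_le_exp.2 ?_) hC
            nlinarith [tdist_nonneg m A B]
  · rw [if_neg hA, ContinuousLinearMap.comp_zero, ContinuousLinearMap.comp_zero, ContinuousLinearMap.comp_zero, norm_zero]
    exact h0

/-! ## §3 The tail letter -/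

include hP hM hμ1 in
/-- **THE CUT-OFF TAIL LETTER FROM BLOCK DECAY**: block family `P` over the coarse torus, `T` with `‖P_{y₁}TP_{y₀}‖ ≤ C·e^{−κ·d_m(y₀,y₁)}` (`C ≥ 0`, `κ > 0`),
a multiplier `M = μ·` with `|μ| ≤ 1` vanishing on every block within distance `r₀` of `Y₀`; then for `f` supported in the blocks over `Y₀`:
`‖M(Tf)‖ ≤ C·latticeConst d (κ∕2)·e^{−(κ∕2)r₀}·‖f‖` — the `hτ` of S-P6′(β) with `M := θ − 1`, `T := R′`. [folklore] (block Schur test)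
[cite: Balaban1985BackgroundPropagators, (3.89) p.409, (3.49) p.399, Cor 3.6 p.408] -/
theorem norm_mul_apply_le_of_block_decay (hm : ∀ i, 1 ≤ m i) (Y₀ : Finset (TSite d m)) {r₀ : ℝ}
    (hnear : ∀ x, (∃ y₀ ∈ Y₀, tdist m y₀ (π x) < r₀) → μ x = 0)
    (T : WL2 𝕜 w V →L[𝕜] WL2 𝕜 w V) {C κ : ℝ} (hC : 0 ≤ C) (hκ : 0 < κ)
    (hdec : ∀ y₀ y₁, ‖P y₁ ∘L T ∘L P y₀‖ ≤ C * Real.exp (-(κ * tdist m y₀ y₁)))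
    (f : WL2 𝕜 w V) (hf : ∀ x, π x ∉ Y₀ → WL2.equiv 𝕜 w V f x = 0) :
    ‖M (T f)‖ ≤ C * latticeConst d (κ / 2) * Real.exp (-(κ / 2 * r₀)) * ‖f‖ := by
  classical
  set α : ℝ := C * Real.exp (-(κ / 2 * r₀)) * latticeConst d (κ / 2) with hα
  have hK : ∀ y : TSite d m, ∑ z, Real.exp (-(κ / 2 * tdist m y z)) ≤ latticeConst d (κ / 2) := fun y => torusSum_le d hm (half_pos hκ) y
  have hK0 : 0 ≤ latticeConst d (κ / 2) := by
    obtain ⟨y⟩ : Nonempty (TSite d m) := ⟨fun i => ⟨0, hm i⟩⟩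
    exact (Finset.sum_nonneg fun z _ => (Real.exp_pos _).le).trans (hK y)
  have hα0 : 0 ≤ α := by rw [hα]; positivity
  -- the Schur test for the single operator `a := M ∘ T ∘ Π_{Y₀}`
  have hent := norm_block_entry_le_far hP hM hμ1 Y₀ hnear T hC hκ.le hdec
  have hrow : ∀ j ∈ ({()} : Finset Unit), ∀ B : TSite d m,
      ∑ A, ‖P B ∘L (fun _ : Unit => M ∘L T ∘L ∑ A' ∈ Y₀, P A') j ∘L P A‖ ≤ α := fun _ _ B => by
    calc ∑ A, ‖P B ∘L (M ∘L T ∘L ∑ A' ∈ Y₀, P A') ∘L P A‖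
        ≤ ∑ A, C * Real.exp (-(κ / 2 * r₀)) * Real.exp (-(κ / 2 * tdist m A B)) := Finset.sum_le_sum fun A _ => hent A B
      _ = C * Real.exp (-(κ / 2 * r₀)) * ∑ A, Real.exp (-(κ / 2 * tdist m B A)) := by
          rw [Finset.mul_sum]; exact Finset.sum_congr rfl fun A _ => by rw [tdist_symm hm]
      _ ≤ α := by rw [hα]; exact mul_le_mul_of_nonneg_left (hK B) (by positivity)
  have hcol : ∀ A : TSite d m, ∑ j ∈ ({()} : Finset Unit), ∑ B, ‖P B ∘L (fun _ : Unit => M ∘L T ∘L ∑ A' ∈ Y₀, P A') j ∘L P A‖ ≤ α := fun A => by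
    rw [Finset.sum_singleton]
    calc ∑ B, ‖P B ∘L (M ∘L T ∘L ∑ A' ∈ Y₀, P A') ∘L P A‖
        ≤ ∑ B, C * Real.exp (-(κ / 2 * r₀)) * Real.exp (-(κ / 2 * tdist m A B)) := Finset.sum_le_sum fun B _ => hent A B
      _ = C * Real.exp (-(κ / 2 * r₀)) * ∑ B, Real.exp (-(κ / 2 * tdist m A B)) := by rw [Finset.mul_sum]
      _ ≤ α := by rw [hα]; exact mul_le_mul_of_nonneg_left (hK A) (by positivity)
  have hsch := family_block_schur_sq ({()} : Finset Unit) P P (fun _ : Unit => M ∘L T ∘L ∑ A' ∈ Y₀, P A')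
    (sum_block_apply hP) (block_comp_self hP) (sum_norm_sq_block_apply_le hP) (norm_sq_le_sum_norm_sq_block_apply hP) hα0 hα0 hrow hcol f
  rw [Finset.sum_singleton] at hsch
  -- `(M ∘ T ∘ Π_{Y₀}) f = M (T f)`
  have e : (M ∘L T ∘L ∑ A' ∈ Y₀, P A') f = M (T f) := by
    rw [ContinuousLinearMap.comp_apply, ContinuousLinearMap.comp_apply, sum_filter_block_apply_eq_self hP Y₀ f hf]
  rw [e] at hsch
  have h2 : ‖M (T f)‖ ^ 2 ≤ (α * ‖f‖) ^ 2 := by rw [mul_pow]; nlinarith [hsch]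
  have h3 := (pow_le_pow_iff_left₀ (norm_nonneg _) (by positivity) two_ne_zero).1 h2
  calc ‖M (T f)‖ ≤ α * ‖f‖ := h3
    _ = C * latticeConst d (κ / 2) * Real.exp (-(κ / 2 * r₀)) * ‖f‖ := by rw [hα]; ring

end Literature.MathematicalPhysics.QuantumFieldTheory.Balaban1983to89.B9Eq389CutoffTailFromBlockDecay

end
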